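import Mathlib.Geometry.Manifold.Instances.Sphere
import Mathlib.Geometry.Manifold.SmoothEmbedding
import Mathlib.Analysis.SpecialFunctions.Complex.Circle
import Literature.Geometry.Kaehler.ManifoldForms
import HarnessLib

/-!
# Folded symplectic and origami forms on 4-manifolds (Cannas da Silva–Guillemin–Pires 2010)

A. Cannas da Silva, V. Guillemin, A. R. Pires, *Symplectic Origami*, IMRN 2011 (18) 4252–4293 =
arXiv:0909.4065 [`CannasdasilvaGuilleminPires2010`], §2.1 (read): "**Definition 2.1.** A folded
symplectic form on a `2n`-dimensional manifold `M` is a closed 2-form `ω` whose top power `ωⁿ`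
vanishes transversally on a submanifold `Z` and whose restriction to that submanifold has maximal
rank. The submanifold `Z` is necessarily of codimension one, embedded and is called the folding
hypersurface or fold. […] The induced restriction `i*ω` has a one-dimensional kernel at each point:
the line field `V` on `Z`, called the null foliation. Note that `V = TZ ∩ E ⊂ i*TM` where `E` is
the rank 2 bundle over `Z` whose fiber at each point is the kernel of `ω`." — "**Definition 2.2.**
An origami manifold is a folded symplectic manifold `(M, ω)` whose null foliation integrates to a
principal `S¹`-fibration, called the null fibration, over a compact base. […] The form `ω` is
called an origami form."

This file spells the two definitions for `n = 2` (`dim M = 4`, model `𝓡 4`) on the tree's carrier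
of differential forms `MForm (𝓡 4) M ℝ 2` (`Literature/Geometry/Kaehler/ManifoldForms`), for the
route `SmoothPoincare4/SymplecticOrigami` (items `OrigamiRung`, `OrigamiFoldExistence`).

## The clauses and how they render the printed words

* closed 2-form: `IsSmoothForm s ∧ IsClosedForm s`;
* the FOLD `fold s := {x | ker (s x) ≠ 0}` (degeneracy locus; on `ℝ⁴`, `det = Pf²`, so this is
  the zero set of the Pfaffian);
* "`ω²` vanishes transversally": `ω ∧ ω = 2 Pf(ω) e⁰¹²³` in a chart, so we ask that the chart
  Pfaffian `y ↦ Pf (s.inChart x₀ y)` (`pfaffian`, on the standard basis of `ℝ⁴`) have non-zero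
  Fréchet derivative at `extChartAt x₀ x₀` for every `x₀ ∈ fold s` (then `fold s` is a regular level
  set, hence an embedded hypersurface — the implicit function theorem, which we do not invoke: the
  hypersurface is carried as DATA, an embedded compact 3-manifold `j : N ↪ M` with
  `range j = fold s`);
* "restriction to `Z` of maximal rank" (rank `2n - 2 = 2`, i.e. `ker (i*ω)` is a line): the
  2-dimensional kernel `E_z` of `s z` is not contained in `T_z Z = range (mfderiv j)` (then
  `V_z = T_z Z ∩ E_z` is 1-dimensional);
* "the null foliation integrates to a principal `S¹`-fibration over a compact base": a smooth FREE
  action of the circle group `Circle` on the compact `N` whose orbits are tangent to the null line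
  field (the fundamental vector field at `n`, pushed forward by `j`, lies in `ker (s (j n))`; it is
  non-zero because the action is free). A free smooth circle action on a compact manifold is a
  principal `S¹`-bundle over the compact quotient (quotient manifold theorem — not invoked; the
  base is not constructed here). The orientation-matching convention of Def. 2.2 for oriented `M`
  is not imposed.

## Contents

`pfaffian`, `fold`, `IsFoldedForm` (Def. 2.1 with the hypersurface as data), `IsOrigamiForm`
(Def. 2.2) with projections `IsOrigamiForm.isFoldedForm`, `.isSmoothForm`, `.isClosedForm`, and the
degenerate inhabitant `IsOrigamiForm.of_isEmpty` (the empty 4-manifold; the honest examples —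
`(S⁴, ω₀|)` with fold the equator and null fibration the Hopf fibration, Example 2.3/2.6 — are not
built here). Not here either: the unfolding / folding correspondence (Prop. 2.8, Thm. 2.26), to be
vendored as a named fact once the route's fold-data carriers are fixed.

## References

* [CannasdasilvaGuilleminPires2010] A. Cannas da Silva, V. Guillemin, A. R. Pires, *Symplectic
  Origami*, Int. Math. Res. Not. IMRN 2011, 4252–4293, doi:10.1093/imrn/rnq241 = arXiv:0909.4065,
  Def. 2.1, Def. 2.2, Example 2.3, Prop. 2.8.
* A. Cannas da Silva, V. Guillemin, C. Woodward, *On the unfolding of folded symplectic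
  structures*, Math. Res. Lett. 7 (2000) 35–53 (folded forms, unfolding).
-/

noncomputable section

open scoped Manifold ContDiff Topology
open Set Function
open Literature.Geometry.Kaehler

namespace Literature.Geometry.Symplectic

/-- Local notation: `𝔼 n` is the model space `EuclideanSpace ℝ (Fin n)`. -/
local notation "𝔼" n:arg => EuclideanSpace ℝ (Fin n)

/-! ### The Pfaffian of a 2-form on `ℝ⁴` -/

/-- The standard basis vector `eᵢ` of `ℝ⁴`. [folklore] -/
def stdVec (i : Fin 4) : 𝔼 4 := EuclideanSpace.single i (1 : ℝ)

/-- **The Pfaffian** of an alternating bilinear form `α` on `ℝ⁴` in the standard basis: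
`Pf α = α(e₀,e₁) α(e₂,e₃) - α(e₀,e₂) α(e₁,e₃) + α(e₀,e₃) α(e₁,e₂)`, so that
`α ∧ α = 2 Pf(α) e⁰∧e¹∧e²∧e³` and `det α = Pf(α)²` (`α` is degenerate iff `Pf α = 0`). [folklore] -/
def pfaffian (α : (𝔼 4) [⋀^Fin 2]→L[ℝ] ℝ) : ℝ :=
  α ![stdVec 0, stdVec 1] * α ![stdVec 2, stdVec 3] - α ![stdVec 0, stdVec 2] * α ![stdVec 1, stdVec 3]
    + α ![stdVec 0, stdVec 3] * α ![stdVec 1, stdVec 2]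

/-- The Pfaffian of the zero form vanishes. [folklore] -/
@[simp] theorem pfaffian_zero : pfaffian 0 = 0 := by simp [pfaffian]

/-- The Pfaffian is quadratic: `Pf (c • α) = c² Pf α`. [folklore] -/
theorem pfaffian_smul (c : ℝ) (α : (𝔼 4) [⋀^Fin 2]→L[ℝ] ℝ) : pfaffian (c • α) = c ^ 2 * pfaffian α := by
  simp only [pfaffian, ContinuousAlternatingMap.smul_apply, smul_eq_mul]
  ring

/-! ### Folded and origami forms on a 4-manifold -/

universe u

variable {M : Type u} [TopologicalSpace M] [ChartedSpace (𝔼 4) M]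

/-- **The fold (degeneracy locus)** of a 2-form `s` on a 4-manifold: the points where `s x` has a
non-zero kernel (equivalently where the chart Pfaffian vanishes). For a folded symplectic form this
is the folding hypersurface `Z` of Def. 2.1. [cite: CannasdasilvaGuilleminPires2010, Def. 2.1] -/
def fold (s : MForm (𝓡 4) M ℝ 2) : Set M :=
  {x | ∃ v : TangentSpace (𝓡 4) x, v ≠ 0 ∧ ∀ w : TangentSpace (𝓡 4) x, s x ![v, w] = 0}

/-- Membership in the fold. [folklore] -/
theorem mem_fold_iff (s : MForm (𝓡 4) M ℝ 2) (x : M) :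
    x ∈ fold s ↔ ∃ v : TangentSpace (𝓡 4) x, v ≠ 0 ∧ ∀ w : TangentSpace (𝓡 4) x, s x ![v, w] = 0 :=
  Iff.rfl

/-- Off the fold the form is non-degenerate. [folklore] -/
theorem forall_ne_zero_of_not_mem_fold {s : MForm (𝓡 4) M ℝ 2} {x : M} (hx : x ∉ fold s)
    {v : TangentSpace (𝓡 4) x} (hv : v ≠ 0) : ∃ w : TangentSpace (𝓡 4) x, s x ![v, w] ≠ 0 := by
  by_contra h
  push Not at h
  exact hx ⟨v, hv, h⟩

/-- **Folded symplectic form on a 4-manifold with folding hypersurface `j : N ↪ M`**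
(Cannas da Silva–Guillemin–Pires 2010, Def. 2.1, `n = 2`): `s` is a smooth closed 2-form; its
fold is the image of the embedded 3-manifold `N` under `j`; `s ∧ s` vanishes TRANSVERSALLY
along the fold (the chart Pfaffian has non-zero derivative at every fold point); and the
restriction of `s` to the fold has MAXIMAL RANK `2`: the (2-dimensional) kernel of `s` at a fold
point is not contained in the tangent space of the fold, so that the null line field
`V = TZ ∩ ker s` is a line field. The hypersurface is carried as data (in print it is derived
from transversality by the implicit function theorem). [cite: CannasdasilvaGuilleminPires2010, Def. 2.1] -/
structure IsFoldedForm (s : MForm (𝓡 4) M ℝ 2) (N : Type) [TopologicalSpace N]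
    [ChartedSpace (𝔼 3) N] (j : N → M) : Prop where
  /-- `s` is smooth. -/
  smooth : IsSmoothForm s
  /-- `s` is closed. -/
  closed : IsClosedForm s
  /-- `j` is a smooth embedding of the 3-manifold `N`. -/
  embedding : Manifold.IsSmoothEmbedding (𝓡 3) (𝓡 4) ∞ j
  /-- The image of `j` is the fold. -/
  range_eq : range j = fold s
  /-- `s ∧ s` vanishes transversally along the fold: the chart Pfaffian has non-zero derivative. -/
  transverse : ∀ x₀ ∈ fold s,
    fderiv ℝ (fun y => pfaffian (s.inChart x₀ y)) (extChartAt (𝓡 4) x₀ x₀) ≠ 0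
  /-- Maximal rank on the fold: `ker (s z) ⊄ T_z Z`. -/
  maximalRank : ∀ n : N, ∃ v : TangentSpace (𝓡 4) (j n),
    (∀ w : TangentSpace (𝓡 4) (j n), s (j n) ![v, w] = 0) ∧
      v ∉ range (mfderiv (𝓡 3) (𝓡 4) j n)

/-- **Origami form on a 4-manifold** (Cannas da Silva–Guillemin–Pires 2010, Def. 2.2, `n = 2`):
a folded symplectic form whose null foliation integrates to a principal `S¹`-fibration over a
compact base — rendered as: there are a COMPACT embedded folding hypersurface `j : N ↪ M`
(`IsFoldedForm`) and a smooth FREE action `θ` of the circle group `Circle` on `N` whose orbits are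
tangent to the null line field (the velocity of `t ↦ j (θ (e^{it}) n)` at `t = 0` lies in
`ker (s (j n))`). The principal-bundle structure `N → N/S¹` and the compact base follow from the
quotient manifold theorem and are not part of the data; the orientation-matching convention for
oriented `M` is not imposed. [cite: CannasdasilvaGuilleminPires2010, Def. 2.2] -/
structure IsOrigamiForm (s : MForm (𝓡 4) M ℝ 2) : Prop where
  /-- The fold data and the null fibration exist. -/
  exists_fold : ∃ (N : Type) (_ : TopologicalSpace N) (_ : ChartedSpace (𝔼 3) N)
      (_ : IsManifold (𝓡 3) ∞ N) (_ : CompactSpace N) (j : N → M) (θ : Circle → N → N),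
    IsFoldedForm s N j ∧
    ContMDiff ((𝓡 1).prod (𝓡 3)) (𝓡 3) ∞ (fun p : Circle × N => θ p.1 p.2) ∧
    (∀ n, θ 1 n = n) ∧ (∀ a b n, θ (a * b) n = θ a (θ b n)) ∧
    (∀ a n, θ a n = n → a = 1) ∧
    (∀ (n : N) (w : TangentSpace (𝓡 4) (j n)),
      s (j n) ![mfderiv 𝓘(ℝ, ℝ) (𝓡 4) (fun t : ℝ => j (θ (Circle.exp t) n)) 0 (1 : ℝ), w] = 0)

namespace IsOrigamiForm

variable {s : MForm (𝓡 4) M ℝ 2}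

/-- An origami form is smooth. [cite: CannasdasilvaGuilleminPires2010, Def. 2.2] -/
theorem isSmoothForm (h : IsOrigamiForm s) : IsSmoothForm s := by
  obtain ⟨N, _, _, _, _, j, θ, hf, -⟩ := h.exists_fold
  exact hf.smooth

/-- An origami form is closed. [cite: CannasdasilvaGuilleminPires2010, Def. 2.2] -/
theorem isClosedForm (h : IsOrigamiForm s) : IsClosedForm s := by
  obtain ⟨N, _, _, _, _, j, θ, hf, -⟩ := h.exists_fold
  exact hf.closed

/-- An origami form is folded: its fold is an embedded compact hypersurface with the transversality
and maximal-rank properties of Def. 2.1. [cite: CannasdasilvaGuilleminPires2010, Def. 2.1] -/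
theorem exists_isFoldedForm (h : IsOrigamiForm s) :
    ∃ (N : Type) (_ : TopologicalSpace N) (_ : ChartedSpace (𝔼 3) N) (_ : IsManifold (𝓡 3) ∞ N)
      (_ : CompactSpace N) (j : N → M), IsFoldedForm s N j := by
  obtain ⟨N, i1, i2, i3, i4, j, θ, hf, -⟩ := h.exists_fold
  exact ⟨N, i1, i2, i3, i4, j, hf⟩

/-- The fold of an origami form is compact (image of the compact hypersurface). [folklore] -/
theorem isCompact_fold (h : IsOrigamiForm s) : IsCompact (fold s) := by
  obtain ⟨N, _, _, _, _, j, θ, hf, -⟩ := h.exists_fold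
  rw [← hf.range_eq]
  exact isCompact_range hf.embedding.isEmbedding.continuous

/-! ### The degenerate inhabitant: the empty 4-manifold -/

/-- On the empty 4-manifold every 2-form is origami (empty fold, empty hypersurface
`(⊥ : Opens ℝ³)`, trivial circle action) — a degenerate but honest inhabitant of the structure;
the genuine examples are `(S⁴, ω₀|_{S⁴})` (Example 2.3) and the origami manifolds obtained by
folding (Thm. 2.26), not built here. [folklore] -/
theorem of_isEmpty [IsEmpty M] (s : MForm (𝓡 4) M ℝ 2) : IsOrigamiForm s := by
  let N : Type := (⊥ : TopologicalSpace.Opens (𝔼 3))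
  haveI hN : IsEmpty N := ⟨fun x => x.2⟩
  refine ⟨⟨N, inferInstance, inferInstance, inferInstance, inferInstance,
    fun n => isEmptyElim n, fun _ n => n, ?_, ?_, ?_, ?_, ?_, ?_⟩⟩
  · refine ⟨fun x => isEmptyElim x, funext fun x => isEmptyElim x, ?_, ?_, fun x => isEmptyElim x,
      fun n => isEmptyElim n⟩
    · refine ⟨⟨𝔼 1, inferInstance, inferInstance, fun n => isEmptyElim n⟩,
        Topology.IsEmbedding.of_subsingleton _⟩
    · ext x
      exact isEmptyElim x
  · exact contMDiff_snd
  · intro n; exact isEmptyElim n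
  · intro a b n; exact isEmptyElim n
  · intro a n; exact isEmptyElim n
  · intro n; exact isEmptyElim n

end IsOrigamiForm

end Literature.Geometry.Symplectic

end
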